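import Summits.Ventures.PercRepro.C041ConeClassG

/-!
# ROW C-041 — THE THREE-EXIT BLOCK MAP, THE THREE-EXIT CYCLE DICTIONARY AND THE CYCLES WITH THREE MARKED VERTICES,
by name (p6, gen 31; the summary module of the three-exit chain)

Every end theorem of the three-exit chain restated with all its hypotheses in the type, for the referees' tree read:
THEOREM (THREE-EXIT BLOCK MAP) (`row_C041_three_exit_block_map`), THE THREE-EXIT CYCLE DICTIONARY
(`row_C041_cycle3_dict`), THEOREM (CYCLES WITH THREE MARKED VERTICES) on the graph model
(`row_C041_cycle3_point_oCube`), the square reduction (`row_C041_cycle3_square_oCube`) and the class `IsZg`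
(`row_C041_IsZg_oCube`).
-/

namespace PercRepro

namespace ZoneZ

open ZoneData TreeClosure RelaxedTriangle TwoExit PointZone

/-- **THEOREM (THREE-EXIT BLOCK MAP)**: the six-vector of an unmarked multigraph `Z₁` with the zones `Z`, `Z'`, `Z''`
hung at `u`, `u'`, `u''`, at the anchor `a₁`, is the sum over the colourings of `Z₁` of the contribution of the
statuses of the three exits. -/
theorem row_C041_three_exit_block_map {V₁ E₁ U₁ U₂ V E T₁ T₂ V' E' T₁' T₂' V'' E'' T₁'' T₂'' : Type}
    (Z₁ : ZoneData V₁ E₁ U₁ U₂) (u u' u'' : V₁) (Z : ZoneData V E T₁ T₂) (a : V) (Z' : ZoneData V' E' T₁' T₂')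
    (a' : V') (Z'' : ZoneData V'' E'' T₁'' T₂'') (a'' : V'') (a₁ : V₁) [Fintype E₁] [DecidableEq E₁] [Fintype E]
    [DecidableEq E] [Fintype T₁] [DecidableEq T₁] [Fintype T₂] [DecidableEq T₂] [Fintype E'] [DecidableEq E']
    [Fintype T₁'] [DecidableEq T₁'] [Fintype T₂'] [DecidableEq T₂'] [Fintype E''] [DecidableEq E'']
    [Fintype T₁''] [DecidableEq T₁''] [Fintype T₂''] [DecidableEq T₂''] :
    (glue3 Z₁ u u' u'' Z a Z' a' Z'' a'').sixVec (Sum.inl (Sum.inl (Sum.inl a₁))) =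
      ∑ ω : E₁ → Bool, contrib3 (Z.sixVec a) (Z'.sixVec a') (Z''.sixVec a'') (Z₁.Mg a₁ u ω) (Z₁.Rd a₁ u ω)
        (Z₁.Mg a₁ u' ω) (Z₁.Rd a₁ u' ω) (Z₁.Mg a₁ u'' ω) (Z₁.Rd a₁ u'' ω) (Z₁.Mg u u' ω) (Z₁.Mg u'' u' ω)
        (Z₁.Mg u'' u ω) :=
  sixVec_glue3 Z₁ u u' u'' Z a Z' a' Z'' a'' a₁

/-- **THE THREE-EXIT CYCLE DICTIONARY**: the six-vector of the cycle `C_{n+1}` through the anchor with `Z`, `Z'`,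
`Z''` at `x_i`, `x_j`, `x_k` (`0 < i < j < k`) is mine-3's arc-type model `thetaSq` with the multiplicities
`2^ℓ − 2` of the four arcs. -/
theorem row_C041_cycle3_dict (n : ℕ) (i j k : Fin (n + 1)) (hi : 0 < i.val) (hij : i.val < j.val)
    (hjk : j.val < k.val) {V E T₁ T₂ V' E' T₁' T₂' V'' E'' T₁'' T₂'' : Type} (Z : ZoneData V E T₁ T₂) (a : V)
    (Z' : ZoneData V' E' T₁' T₂') (a' : V') (Z'' : ZoneData V'' E'' T₁'' T₂'') (a'' : V'') [Fintype E]
    [DecidableEq E] [Fintype T₁] [DecidableEq T₁] [Fintype T₂] [DecidableEq T₂] [Fintype E'] [DecidableEq E']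
    [Fintype T₁'] [DecidableEq T₁'] [Fintype T₂'] [DecidableEq T₂'] [Fintype E''] [DecidableEq E'']
    [Fintype T₁''] [DecidableEq T₁''] [Fintype T₂''] [DecidableEq T₂''] :
    (cyc3 n i j k Z a Z' a' Z'' a'').sixVec (Sum.inl (Sum.inl (Sum.inl 0))) =
      thetaSq ((2 : ℝ) ^ i.val - 2) ((2 : ℝ) ^ (j.val - i.val) - 2) ((2 : ℝ) ^ (k.val - j.val) - 2)
        ((2 : ℝ) ^ (n + 1 - k.val) - 2) (Z.sixVec a) (Z'.sixVec a') (Z''.sixVec a'') :=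
  sixVec_cyc3 n i j k Z a Z' a' Z'' a'' hi hij hjk

/-- **THEOREM (CYCLES WITH THREE MARKED VERTICES), on the graph model**: the ZONE O-CUBE on every cycle through the
anchor carrying three marked vertices of any marks, any length, any positions. -/
theorem row_C041_cycle3_point_oCube (n : ℕ) (i j k : Fin (n + 1)) (hi : 0 < i.val) (hij : i.val < j.val)
    (hjk : j.val < k.val) (p q p' q' p'' q'' : ℕ) :
    (cyc3 n i j k (pointZone p q) () (pointZone p' q') () (pointZone p'' q'') ()).ZoneOCubeConj
      {Sum.inl (Sum.inl (Sum.inl 0))} (∅ : Set (((Fin (n + 1) ⊕ Unit) ⊕ Unit) ⊕ Unit)) :=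
  zoneOCubeConj_cyc3_point n i j k hi hij hjk p q p' q' p'' q''

/-- **The three-exit cycle reduces to the square map**: three cone inputs whose square map is in the cone satisfy
the ZONE O-CUBE on every three-exit cycle zone. -/
theorem row_C041_cycle3_square_oCube (n : ℕ) (i j k : Fin (n + 1)) (hi : 0 < i.val) (hij : i.val < j.val)
    (hjk : j.val < k.val) {V E T₁ T₂ V' E' T₁' T₂' V'' E'' T₁'' T₂'' : Type} (Z : ZoneData V E T₁ T₂) (a : V)
    (Z' : ZoneData V' E' T₁' T₂') (a' : V') (Z'' : ZoneData V'' E'' T₁'' T₂'') (a'' : V'') [Fintype E]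
    [DecidableEq E] [Fintype T₁] [DecidableEq T₁] [Fintype T₂] [DecidableEq T₂] [Fintype E'] [DecidableEq E']
    [Fintype T₁'] [DecidableEq T₁'] [Fintype T₂'] [DecidableEq T₂'] [Fintype E''] [DecidableEq E'']
    [Fintype T₁''] [DecidableEq T₁''] [Fintype T₂''] [DecidableEq T₂''] (h : InCone (Z.sixVec a))
    (h' : InCone (Z'.sixVec a')) (h'' : InCone (Z''.sixVec a''))
    (hsq : InCone (square (Z.sixVec a) (Z'.sixVec a') (Z''.sixVec a''))) :
    (cyc3 n i j k Z a Z' a' Z'' a'').ZoneOCubeConj {Sum.inl (Sum.inl (Sum.inl 0))}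
      (∅ : Set (((Fin (n + 1) ⊕ V') ⊕ V) ⊕ V'')) :=
  zoneOCubeConj_cyc3_of_square n i j k Z a Z' a' Z'' a'' hi hij hjk h h' h'' hsq

/-- **THE ZONE O-CUBE ON THE CLASS WITH MARKED TWO- AND THREE-EXIT CYCLES.** -/
theorem row_C041_IsZg_oCube {V E T₁ T₂ : Type} (Z : ZoneData V E T₁ T₂) (k : V) (h : IsZg Z k) [Fintype E]
    [DecidableEq E] [Fintype T₁] [DecidableEq T₁] [Fintype T₂] [DecidableEq T₂] :
    Z.ZoneOCubeConj {k} (∅ : Set V) :=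
  h.zoneOCubeConj

end ZoneZ

end PercRepro
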